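/-
Copyright (c) 2026 the pub-hodgecm-mathlib formalisation cell (harness21).  Prover seat hodgecm-mathlib-F0P3a-p02 (g17): road «S3-ram» (junction pen F0P3a-p01 (g17),
J-PACK v2 (f) isoceles wave, sockets S5∕S5′ «ROOT LINE CENSUS»; lattice halves F0P3-p03 (g15)), the residual census AT THE ROOT of an isoceles literal; 2026-09-02.
-/
import Literature.NumberTheory.Rogawski1990.DepthZeroKappaTransferTypeOneRamifiedAxisAdaptedCensus   -- ★ p847624 (this seat): `sum_quadraticChar_mul_add_mul_sq`, brings ★ collar census
import Literature.LinearAlgebra.QuadraticFormCountCongruence                                       -- ★ p847552 (this seat): frame change `x ↦ Ax`, `k³ ≃ Fin 3 → k`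
import Literature.GroupTheory.SpecificGroups.OrthogonalThreeIsotropicParamsClassCount               -- ★ p847443 (F0P2-p06): `(q−1)·#{params} = #{vectors}` on the conic
import HarnessLib

/-!
# The residual census AT THE ROOT of an isoceles type-(1) literal: isotropic vectors of the DIAGONAL Gram `δ₀x₀² + δ₁x₁² + δ₂x₂²` cut by the class of
# `Q = Σ δₘȳₘxₘ²` with `ȳ_j = ȳ_l` on the close pair — the root plane decides everything (Rogawski 1990 §4.9; Kottwitz 1986 §3)

Topic `NumberTheory/Rogawski1990`; namespace `Literature.NumberTheory.Rogawski1990`.  THEOREMS ONLY (no definition, no instance, no notation, no named fact, no `sorry`); kernel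
lane `--supports stmt-HodgeConjecture-24833`.  Cell `pub/hodgecm-mathlib` (D-0151), crux H413; road «S3-ram» (count-neutral); junction J-PACK v2 (F0P3a-p01 (g17)) iso sockets
S5∕S5′ (hand F0P3a-p02 (g17), statement-first `F0/P3a/F0P3a-p02/g17/iso/JunctionSocketsS45.statementfirst.v3…lean`).

THE MATHEMATICS.  At the root `r₀` of an isoceles literal `γ = A·diag(s)·A⁻¹` (`A ∈ GL₃(𝒪)` with `J₀`-orthogonal columns of unit norms, `hdA`), the residual leading matrix
`Ȳ = (ϖ^{d₀})⁻¹(γ − 1) mod ϖ` is `Ā·diag(ȳ)·Ā⁻¹` with `ȳ_j = ȳ_l ≠ ȳ_{i₀}` (`i₀` the isolated index), and in the eigen-coordinates `x = Āb` the residual Gram is DIAGONAL,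
`ᵗĀJ̄₀Ā = diag(δ)`.  On an isotropic `b` (`Σ δₘbₘ² = 0`) the line value is `Q(b) = Σ δₘȳₘbₘ² = (ȳ_{i₀} − ȳ_j)·δ_{i₀}·b_{i₀}²`: it is NULL iff `b_{i₀} = 0`, i.e. iff `b̄` is
isotropic INSIDE THE ROOT PLANE `ū_{i₀}^⊥` — `1 + χ(−δ_jδ_l)` lines (`2` if the plane is residually hyperbolic, `0` if anisotropic: F0P3-p03 (g15) 01:51:12Z, B-p14 (g39)
01:51:23Z) —, and otherwise lies in the ONE square class of `c := (ȳ_{i₀} − ȳ_j)·δ_{i₀}` (`q − χ(−δ_jδ_l)` lines).  THIS FILE proves exactly that, as finite-field counting: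
* §1 binary diagonal forms: `#{(y,z) : δ₁y² + δ₂z² = a} = q + (q−1)χ(−δ₁δ₂)` (`a = 0`), `= q − χ(−δ₁δ₂)` (`a ≠ 0`);
* §2 the census in `k × k × k` (isolated coordinate first): `#{v ≠ 0 : Σδv² = 0 ∧ P(c·v.1²)} = (q−1)·((1 + χ(−δ₁δ₂))·[P 0] + (q − χ(−δ₁δ₂))·[P c])` for every
  predicate `P` invariant under non-zero squares, and its two coordinate-permuted twins;
* §3 the census in the `Fin 3 → k` MATRIX currency of ★ `QuadraticFormCountCongruence` (`x ⬝ᵥ (diagonal δ *ᵥ x)`, `x ⬝ᵥ ((diagonal δ * diagonal y) *ᵥ x)`, any isolated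
  index `i₀`), then in the `J̄₀`-currency after the frame change `Ā` (`ᵗĀJ̄₀Ā = diagonal δ`, `Ā⁻¹ȲĀ = diagonal y`), and finally in the NORMALISED-PARAMETER currency of the
  ★ root bridge `UnitaryLatticeTree.ncard_neighborSet_root_pred_eq_natCard` (★ G3⁗, F0P2-p06): **`#{p : P(Q_Ȳ(x̄_p))} = (1 + χ(−δ_jδ_l))·[P 0] + (q − χ(−δ_jδ_l))·[P c]`**,
  with the NULL (`1 + χ`, resp. all `q + 1` when `c = 0`) and CLASS (`(q − χ)·[P c]`) corollaries: ROOT LINE CENSUS `(2, q−1, 0)` for a hyperbolic root plane, `(0, q+1, 0)`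
  for an anisotropic one (sockets S5 at `r₀` ∕ S5′).
HONEST LABEL: HC_CM is proved only modulo the 2 remaining named inputs (hLiu418 24832, h413 24833) until rung 0 closes; finite-field algebra only, nothing printed is asserted.

## References
* [Rogawski1990] J. D. Rogawski, *Automorphic Representations of Unitary Groups in Three Variables*, Ann. of Math. Stud. 123 (1990), §4.9 Prop. 4.9.1 p. 55.
* [Kottwitz1986] R. E. Kottwitz, *Base change for unit elements of Hecke algebras*, Compositio Math. 60 (1986), §3 (counting fixed lattices by residual data).
* [IrelandRosen1990] K. Ireland, M. Rosen, *A Classical Introduction to Modern Number Theory*, GTM 84, Ch. 8 §1–§2 (quadratic character, `#{x² = a} = 1 + χ(a)`).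
* [LidlNiederreiter1996] R. Lidl, H. Niederreiter, *Finite Fields*, 2nd ed. (1996), Thm. 6.26–6.27 (number of solutions of diagonal quadratic equations).
-/

set_option autoImplicit false

namespace Literature.NumberTheory.Rogawski1990

open Finset Matrix
open Literature.NumberTheory.Automorphic Literature.NumberTheory.Automorphic.HermitianLattice Literature.NumberTheory.Automorphic.UnitaryGroup
open Literature.LinearAlgebra.QuadraticFormCountCongruence Literature.GroupTheory.SpecificGroups

variable {k : Type*} [Field k] [Fintype k] [DecidableEq k]

/-! ## §1 Binary diagonal forms `δ₁y² + δ₂z² = a` -/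

/-- `Σ_z [z² = b] = χ(b) + 1` (Mathlib's `quadraticChar_card_sqrts` in sum form). [cite: IrelandRosen1990, Ch. 8 §1] -/
theorem sum_ite_sq_eq_eq (hk : ringChar k ≠ 2) (b : k) : ∑ z : k, (if z ^ 2 = b then (1 : ℤ) else 0) = quadraticChar k b + 1 := by
  have h := quadraticChar_card_sqrts hk b
  rw [Set.toFinset_setOf, Finset.card_filter] at h
  push_cast at h
  exact h

/-- **`#{(y, z) : δ₁y² + δ₂z² = a} = q + Σ_y χ((a − δ₁y²)∕δ₂)`** (`δ₂ ≠ 0`, `char ≠ 2`): count `z` first. [cite: IrelandRosen1990, Ch. 8 §1] [cite: LidlNiederreiter1996, Thm. 6.26] -/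
theorem card_filter_binary_diag_eq_sum (hk : ringChar k ≠ 2) (δ₁ : k) {δ₂ : k} (hδ₂ : δ₂ ≠ 0) (a : k) :
    ((univ.filter fun p : k × k => δ₁ * p.1 ^ 2 + δ₂ * p.2 ^ 2 = a).card : ℤ) = Fintype.card k + ∑ y : k, quadraticChar k ((a - δ₁ * y ^ 2) / δ₂) := by
  rw [Finset.card_filter]
  push_cast
  rw [Fintype.sum_prod_type]
  have inner : ∀ y : k, ∑ z : k, (if δ₁ * (y, z).1 ^ 2 + δ₂ * (y, z).2 ^ 2 = a then (1 : ℤ) else 0) = quadraticChar k ((a - δ₁ * y ^ 2) / δ₂) + 1 := by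
    intro y
    rw [← sum_ite_sq_eq_eq hk ((a - δ₁ * y ^ 2) / δ₂)]
    refine Finset.sum_congr rfl fun z _ => ?_
    have hiff : δ₁ * y ^ 2 + δ₂ * z ^ 2 = a ↔ z ^ 2 = (a - δ₁ * y ^ 2) / δ₂ := by
      rw [eq_div_iff hδ₂]
      constructor <;> intro h <;> linear_combination h
    by_cases h : δ₁ * y ^ 2 + δ₂ * z ^ 2 = a
    · rw [if_pos h, if_pos (hiff.1 h)]
    · rw [if_neg h, if_neg (fun h' => h (hiff.2 h'))]
  simp_rw [inner, Finset.sum_add_distrib, Finset.sum_const, Finset.card_univ, nsmul_eq_mul, mul_one]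
  ring

/-- **`#{(y, z) : δ₁y² + δ₂z² = 0} = q + (q − 1)·χ(−δ₁δ₂)`** (`δ₂ ≠ 0`; for `δ₁ = 0` both sides are `q`): the plane is residually hyperbolic (`2(q−1)` non-zero isotropic vectors) iff `−δ₁δ₂` is a square,
anisotropic (none) otherwise. [cite: LidlNiederreiter1996, Thm. 6.26] [cite: IrelandRosen1990, Ch. 8 §2] -/
theorem card_filter_binary_diag_zero (hk : ringChar k ≠ 2) (δ₁ : k) {δ₂ : k} (hδ₂ : δ₂ ≠ 0) :
    ((univ.filter fun p : k × k => δ₁ * p.1 ^ 2 + δ₂ * p.2 ^ 2 = 0).card : ℤ) = Fintype.card k + (Fintype.card k - 1) * quadraticChar k (-(δ₁ * δ₂)) := by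
  rw [card_filter_binary_diag_eq_sum hk δ₁ hδ₂ 0]
  have hterm : ∀ y : k, quadraticChar k ((0 - δ₁ * y ^ 2) / δ₂) = quadraticChar k (-(δ₁ * δ₂)) - (if y = 0 then quadraticChar k (-(δ₁ * δ₂)) else 0) := by
    intro y
    by_cases hy : y = 0
    · rw [if_pos hy, hy]; simp
    · rw [if_neg hy, sub_zero, show (0 - δ₁ * y ^ 2) / δ₂ = -(δ₁ * δ₂) * (y / δ₂) ^ 2 by field_simp; ring, map_mul, quadraticChar_sq_one' (div_ne_zero hy hδ₂), mul_one]
  simp_rw [hterm, Finset.sum_sub_distrib, Finset.sum_const, Finset.card_univ, nsmul_eq_mul, Finset.sum_ite_eq' univ (0 : k), if_pos (Finset.mem_univ _)]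
  ring

/-- **`#{(y, z) : δ₁y² + δ₂z² = a} = q − χ(−δ₁δ₂)`** for `a ≠ 0` (`δ₁, δ₂ ≠ 0`): a regular binary form represents every non-zero value `q − χ(−disc)` times
(★ `sum_quadraticChar_mul_add_mul_sq`). [cite: LidlNiederreiter1996, Thm. 6.26] [cite: IrelandRosen1990, Ch. 8 §2] -/
theorem card_filter_binary_diag_of_ne_zero (hk : ringChar k ≠ 2) {δ₁ δ₂ a : k} (hδ₁ : δ₁ ≠ 0) (hδ₂ : δ₂ ≠ 0) (ha : a ≠ 0) :
    ((univ.filter fun p : k × k => δ₁ * p.1 ^ 2 + δ₂ * p.2 ^ 2 = a).card : ℤ) = Fintype.card k - quadraticChar k (-(δ₁ * δ₂)) := by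
  rw [card_filter_binary_diag_eq_sum hk δ₁ hδ₂ a]
  have hterm : ∀ y : k, quadraticChar k ((a - δ₁ * y ^ 2) / δ₂) = quadraticChar k (δ₂⁻¹ * (a + -δ₁ * y ^ 2)) := fun y => by
    congr 1; field_simp; ring
  simp_rw [hterm]
  rw [sum_quadraticChar_mul_add_mul_sq hk ha (neg_ne_zero.2 hδ₁) (inv_ne_zero hδ₂),
    show δ₂⁻¹ * -δ₁ = -(δ₁ * δ₂) * δ₂⁻¹ ^ 2 by field_simp, map_mul, quadraticChar_sq_one' (inv_ne_zero hδ₂), mul_one]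
  ring

/-! ## §2 The census in `k × k × k` (isolated coordinate `v.1`; plane coordinates `v.2.1, v.2.2`) -/

/-- THE PLANE: `#{v ≠ 0 : v.1 = 0 ∧ δ₀v.1² + δ₁v.2.1² + δ₂v.2.2² = 0} = (q − 1)·(1 + χ(−δ₁δ₂))` — the non-zero isotropic vectors of the root plane.
[cite: LidlNiederreiter1996, Thm. 6.26] [cite: Kottwitz1986, §3] -/
theorem card_iso_diag_plane (hk : ringChar k ≠ 2) (δ₀ δ₁ : k) {δ₂ : k} (hδ₂ : δ₂ ≠ 0) :
    ((univ.filter fun v : k × k × k => v ≠ 0 ∧ v.1 = 0 ∧ δ₀ * v.1 ^ 2 + δ₁ * v.2.1 ^ 2 + δ₂ * v.2.2 ^ 2 = 0).card : ℤ) =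
      (Fintype.card k - 1) * (1 + quadraticChar k (-(δ₁ * δ₂))) := by
  -- `v ↦ v.2` onto the non-zero isotropic vectors of the plane, counted by §1 minus the origin
  have hbij : (univ.filter fun v : k × k × k => v ≠ 0 ∧ v.1 = 0 ∧ δ₀ * v.1 ^ 2 + δ₁ * v.2.1 ^ 2 + δ₂ * v.2.2 ^ 2 = 0).card =
      ((univ.filter fun p : k × k => δ₁ * p.1 ^ 2 + δ₂ * p.2 ^ 2 = 0).erase 0).card := by
    refine Finset.card_bij (fun v _ => v.2) (fun v hv => ?_) (fun v₁ hv₁ v₂ hv₂ h => ?_) (fun p hp => ?_)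
    · rw [Finset.mem_filter] at hv
      obtain ⟨-, hv0, hv1, hiso⟩ := hv
      rw [Finset.mem_erase, Finset.mem_filter]
      refine ⟨fun h0 => hv0 (Prod.ext hv1 h0), Finset.mem_univ _, ?_⟩
      rw [hv1] at hiso
      linear_combination hiso
    · rw [Finset.mem_filter] at hv₁ hv₂
      exact Prod.ext (by rw [hv₁.2.2.1, hv₂.2.2.1]) h
    · rw [Finset.mem_erase, Finset.mem_filter] at hp
      obtain ⟨hp0, -, hiso⟩ := hp
      refine ⟨(0, p), ?_, rfl⟩
      rw [Finset.mem_filter]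
      refine ⟨Finset.mem_univ _, fun h0 => hp0 (congrArg Prod.snd h0), rfl, ?_⟩
      linear_combination hiso
  have hmem : (0 : k × k) ∈ univ.filter fun p : k × k => δ₁ * p.1 ^ 2 + δ₂ * p.2 ^ 2 = 0 := by
    rw [Finset.mem_filter]; exact ⟨Finset.mem_univ _, by simp⟩
  rw [hbij, Finset.card_erase_of_mem hmem, Nat.cast_sub (Finset.card_pos.2 ⟨0, hmem⟩), Nat.cast_one, card_filter_binary_diag_zero hk δ₁ hδ₂]
  ring

/-- OFF THE PLANE: `#{v : v.1 ≠ 0 ∧ δ₀v.1² + δ₁v.2.1² + δ₂v.2.2² = 0} = (q − 1)·(q − χ(−δ₁δ₂))` (`δ₀, δ₁, δ₂ ≠ 0`): for each `v.1 ≠ 0` the plane form represents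
`−δ₀v.1² ≠ 0` exactly `q − χ(−δ₁δ₂)` times. [cite: LidlNiederreiter1996, Thm. 6.27] [cite: Kottwitz1986, §3] -/
theorem card_iso_diag_offPlane (hk : ringChar k ≠ 2) {δ₀ δ₁ δ₂ : k} (hδ₀ : δ₀ ≠ 0) (hδ₁ : δ₁ ≠ 0) (hδ₂ : δ₂ ≠ 0) :
    ((univ.filter fun v : k × k × k => v.1 ≠ 0 ∧ δ₀ * v.1 ^ 2 + δ₁ * v.2.1 ^ 2 + δ₂ * v.2.2 ^ 2 = 0).card : ℤ) =
      (Fintype.card k - 1) * (Fintype.card k - quadraticChar k (-(δ₁ * δ₂))) := by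
  rw [Finset.card_filter]
  push_cast
  rw [Fintype.sum_prod_type]
  have inner : ∀ a : k, ∑ p : k × k, (if (a, p).1 ≠ 0 ∧ δ₀ * (a, p).1 ^ 2 + δ₁ * (a, p).2.1 ^ 2 + δ₂ * (a, p).2.2 ^ 2 = 0 then (1 : ℤ) else 0) =
      (Fintype.card k - quadraticChar k (-(δ₁ * δ₂))) - (if a = 0 then (Fintype.card k - quadraticChar k (-(δ₁ * δ₂))) else 0) := by
    intro a
    by_cases ha : a = 0
    · rw [if_pos ha, sub_self]
      refine Finset.sum_eq_zero fun p _ => ?_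
      rw [if_neg]
      exact fun h => h.1 ha
    · rw [if_neg ha, sub_zero, ← card_filter_binary_diag_of_ne_zero hk hδ₁ hδ₂ (a := -(δ₀ * a ^ 2)) (neg_ne_zero.2 (mul_ne_zero hδ₀ (pow_ne_zero 2 ha))),
        Finset.card_filter]
      push_cast
      refine Finset.sum_congr rfl fun p _ => ?_
      have hiff : (a ≠ 0 ∧ δ₀ * a ^ 2 + δ₁ * p.1 ^ 2 + δ₂ * p.2 ^ 2 = 0) ↔ δ₁ * p.1 ^ 2 + δ₂ * p.2 ^ 2 = -(δ₀ * a ^ 2) := by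
        constructor
        · rintro ⟨-, h⟩; linear_combination h
        · intro h; exact ⟨ha, by linear_combination h⟩
      by_cases h : a ≠ 0 ∧ δ₀ * a ^ 2 + δ₁ * p.1 ^ 2 + δ₂ * p.2 ^ 2 = 0
      · rw [if_pos h, if_pos (hiff.1 h)]
      · rw [if_neg h, if_neg (fun h' => h (hiff.2 h'))]
  simp_rw [inner, Finset.sum_sub_distrib, Finset.sum_const, Finset.card_univ, nsmul_eq_mul, Finset.sum_ite_eq' univ (0 : k), if_pos (Finset.mem_univ _)]
  ring

/-- **THE ROOT CENSUS in `k × k × k`** (isolated coordinate `v.1`): for `δ₀, δ₁, δ₂ ≠ 0`, any `c` and any predicate `P` invariant under non-zero squares,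
`#{v ≠ 0 : δ₀v.1² + δ₁v.2.1² + δ₂v.2.2² = 0 ∧ P(c·v.1²)} = (q − 1)·((1 + χ(−δ₁δ₂))·[P 0] + (q − χ(−δ₁δ₂))·[P c])`: on the plane `v.1 = 0` the value is `0`, off it the
value `c·v.1²` lies in the class of `c`. [cite: Rogawski1990, §4.9 Prop. 4.9.1 p. 55] [cite: Kottwitz1986, §3] -/
theorem card_iso_rootFrame_prod_pred_eq (hk : ringChar k ≠ 2) {δ₀ δ₁ δ₂ : k} (hδ₀ : δ₀ ≠ 0) (hδ₁ : δ₁ ≠ 0) (hδ₂ : δ₂ ≠ 0) (c : k)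
    (P : k → Prop) [DecidablePred P] (hP : ∀ t z : k, z ≠ 0 → (P (z ^ 2 * t) ↔ P t)) :
    ((univ.filter fun v : k × k × k => v ≠ 0 ∧ δ₀ * v.1 ^ 2 + δ₁ * v.2.1 ^ 2 + δ₂ * v.2.2 ^ 2 = 0 ∧ P (c * v.1 ^ 2)).card : ℤ) =
      (Fintype.card k - 1) * ((1 + quadraticChar k (-(δ₁ * δ₂))) * (if P 0 then 1 else 0) + (Fintype.card k - quadraticChar k (-(δ₁ * δ₂))) * (if P c then 1 else 0)) := by
  set S := univ.filter fun v : k × k × k => v ≠ 0 ∧ δ₀ * v.1 ^ 2 + δ₁ * v.2.1 ^ 2 + δ₂ * v.2.2 ^ 2 = 0 ∧ P (c * v.1 ^ 2) with hS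
  have hsplit := (Finset.card_filter_add_card_filter_not (s := S) (fun v => v.1 = 0)).symm
  rw [hS, Finset.filter_filter, Finset.filter_filter] at hsplit
  -- on the plane: the predicate is `P 0`
  have hplane : (univ.filter fun v : k × k × k => (v ≠ 0 ∧ δ₀ * v.1 ^ 2 + δ₁ * v.2.1 ^ 2 + δ₂ * v.2.2 ^ 2 = 0 ∧ P (c * v.1 ^ 2)) ∧ v.1 = 0) =
      if P 0 then univ.filter fun v : k × k × k => v ≠ 0 ∧ v.1 = 0 ∧ δ₀ * v.1 ^ 2 + δ₁ * v.2.1 ^ 2 + δ₂ * v.2.2 ^ 2 = 0 else ∅ := by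
    split_ifs with h0
    · refine Finset.filter_congr fun v _ => ⟨?_, ?_⟩
      · rintro ⟨⟨hv0, hiso, -⟩, h1⟩; exact ⟨hv0, h1, hiso⟩
      · rintro ⟨hv0, h1, hiso⟩; refine ⟨⟨hv0, hiso, ?_⟩, h1⟩; rw [h1]; simpa using h0
    · rw [Finset.filter_eq_empty_iff]
      rintro v - ⟨⟨-, -, hPv⟩, h1⟩
      rw [h1] at hPv; apply h0; simpa using hPv
  -- off the plane: the predicate is `P c`
  have hoff : (univ.filter fun v : k × k × k => (v ≠ 0 ∧ δ₀ * v.1 ^ 2 + δ₁ * v.2.1 ^ 2 + δ₂ * v.2.2 ^ 2 = 0 ∧ P (c * v.1 ^ 2)) ∧ ¬ v.1 = 0) =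
      if P c then univ.filter fun v : k × k × k => v.1 ≠ 0 ∧ δ₀ * v.1 ^ 2 + δ₁ * v.2.1 ^ 2 + δ₂ * v.2.2 ^ 2 = 0 else ∅ := by
    split_ifs with hc
    · refine Finset.filter_congr fun v _ => ⟨?_, ?_⟩
      · rintro ⟨⟨-, hiso, -⟩, h1⟩; exact ⟨h1, hiso⟩
      · rintro ⟨h1, hiso⟩
        refine ⟨⟨fun h0 => h1 (by rw [h0]; rfl), hiso, ?_⟩, h1⟩
        rw [mul_comm]; exact (hP c v.1 h1).2 hc
    · rw [Finset.filter_eq_empty_iff]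
      rintro v - ⟨⟨-, -, hPv⟩, h1⟩
      rw [mul_comm] at hPv; exact hc ((hP c v.1 h1).1 hPv)
  rw [hsplit, hplane, hoff]
  push_cast
  split_ifs with h0 hc <;>
    simp only [Finset.card_empty, Nat.cast_zero, card_iso_diag_plane hk δ₀ δ₁ hδ₂, card_iso_diag_offPlane hk hδ₀ hδ₁ hδ₂] <;> ring

/-! ## §3 The census in the `Fin 3 → k` matrix currency, any isolated index; the `J̄₀`-frame and the normalised parameters -/

/-- Three pairwise distinct indices exhaust `Fin 3` (private index plumbing). [folklore] -/
private theorem fin_three_eq_or_of_distinct (i₀ j l m : Fin 3) (hij : i₀ ≠ j) (hil : i₀ ≠ l) (hjl : j ≠ l) : m = i₀ ∨ m = j ∨ m = l := by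
  revert i₀ j l m hij hil hjl
  decide

/-- `Σ_m f m = f i₀ + f j + f l` for pairwise distinct `i₀, j, l : Fin 3` (private index plumbing). [folklore] -/
private theorem sum_univ_fin_three_of_distinct {β : Type*} [AddCommMonoid β] (f : Fin 3 → β) {i₀ j l : Fin 3} (hij : i₀ ≠ j) (hil : i₀ ≠ l) (hjl : j ≠ l) :
    ∑ m, f m = f i₀ + f j + f l := by
  have huniv : (univ : Finset (Fin 3)) = {i₀, j, l} := by
    ext m
    simp only [Finset.mem_univ, Finset.mem_insert, Finset.mem_singleton, true_iff]
    exact fin_three_eq_or_of_distinct i₀ j l m hij hil hjl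
  rw [huniv, Finset.sum_insert (by simp [hij, hil]), Finset.sum_insert (by simp [hjl]), Finset.sum_singleton, add_assoc]

omit [Field k] [DecidableEq k] in
/-- COORDINATES: `#{w : Fin 3 → k | R(w i₀, w j, w l)} = #{v : k × k × k | R(v.1, v.2.1, v.2.2)}` for pairwise distinct `i₀, j, l` (★ `card_filter_prod_three_eq_card_filter_fin_three`
is the case `(0, 1, 2)`). [cite: IrelandRosen1990, Ch. 8 §1] -/
theorem card_filter_fin_three_coords_eq {i₀ j l : Fin 3} (hij : i₀ ≠ j) (hil : i₀ ≠ l) (hjl : j ≠ l) (R : k → k → k → Prop) [∀ a b c, Decidable (R a b c)] :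
    (univ.filter fun w : Fin 3 → k => R (w i₀) (w j) (w l)).card = (univ.filter fun v : k × k × k => R v.1 v.2.1 v.2.2).card := by
  refine Finset.card_bij (fun w _ => (w i₀, w j, w l)) (fun w hw => ?_) (fun w₁ _ w₂ _ h => ?_) (fun v hv => ?_)
  · rw [Finset.mem_filter] at hw ⊢; exact ⟨Finset.mem_univ _, hw.2⟩
  · obtain ⟨h1, h2, h3⟩ := Prod.ext_iff.1 h |>.imp id (fun h' => Prod.ext_iff.1 h')
    funext m
    rcases fin_three_eq_or_of_distinct i₀ j l m hij hil hjl with rfl | rfl | rfl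
    exacts [h1, h2, h3]
  · refine ⟨fun m => if m = i₀ then v.1 else if m = j then v.2.1 else v.2.2, ?_, ?_⟩
    · rw [Finset.mem_filter] at hv ⊢
      refine ⟨Finset.mem_univ _, ?_⟩
      simpa only [eq_self_iff_true, if_true, Ne.symm hij, Ne.symm hil, Ne.symm hjl, if_false] using hv.2
    · simp only [if_true, Ne.symm hij, Ne.symm hil, Ne.symm hjl, if_false]

omit [Fintype k] [DecidableEq k] in
/-- `ᵗw·diag(δ)·w = Σ δₘwₘ²` — the diagonal quadratic form as a sum. [cite: LidlNiederreiter1996, Ch. 6 §2] -/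
theorem dotProduct_diagonal_mulVec_self (δ w : Fin 3 → k) : w ⬝ᵥ (diagonal δ *ᵥ w) = ∑ m, δ m * w m ^ 2 := by
  simp only [dotProduct, mulVec_diagonal]
  exact Finset.sum_congr rfl fun m _ => by ring

omit [Fintype k] [DecidableEq k] in
/-- `ᵗw·(diag(δ)·diag(y))·w = Σ δₘyₘwₘ²` — a diagonal quadratic form as a sum. [cite: LidlNiederreiter1996, Ch. 6 §2] -/
theorem dotProduct_diagonal_mul_diagonal_mulVec_self (δ y w : Fin 3 → k) : w ⬝ᵥ ((diagonal δ * diagonal y) *ᵥ w) = ∑ m, δ m * y m * w m ^ 2 := by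
  simp only [diagonal_mul_diagonal, dotProduct, mulVec_diagonal]
  exact Finset.sum_congr rfl fun m _ => by ring

/-- **THE ROOT CENSUS, matrix currency** (Gram `diagonal δ`, value matrix `diagonal δ * diagonal y`, isolated index `i₀`, close pair `y j = y l`): for every predicate `P`
invariant under non-zero squares,
`#{w ≠ 0 : ᵗw·diag(δ)·w = 0 ∧ P(ᵗw·diag(δ)diag(y)·w)} = (q − 1)·((1 + χ(−δ_jδ_l))·[P 0] + (q − χ(−δ_jδ_l))·[P((y_{i₀} − y_j)δ_{i₀})])` — on the cone the value is
`(y_{i₀} − y_j)·δ_{i₀}·w_{i₀}²`. [cite: Rogawski1990, §4.9 Prop. 4.9.1 p. 55] [cite: Kottwitz1986, §3] -/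
theorem card_iso_rootFrame_pred_eq (hk : ringChar k ≠ 2) {i₀ j l : Fin 3} (hij : i₀ ≠ j) (hil : i₀ ≠ l) (hjl : j ≠ l)
    (δ : Fin 3 → k) (hδ : ∀ m, δ m ≠ 0) (y : Fin 3 → k) (hy : y j = y l)
    (P : k → Prop) [DecidablePred P] (hP : ∀ t z : k, z ≠ 0 → (P (z ^ 2 * t) ↔ P t)) :
    ((univ.filter fun w : Fin 3 → k => w ≠ 0 ∧ w ⬝ᵥ (diagonal δ *ᵥ w) = 0 ∧ P (w ⬝ᵥ ((diagonal δ * diagonal y) *ᵥ w))).card : ℤ) =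
      (Fintype.card k - 1) * ((1 + quadraticChar k (-(δ j * δ l))) * (if P 0 then 1 else 0) +
        (Fintype.card k - quadraticChar k (-(δ j * δ l))) * (if P ((y i₀ - y j) * δ i₀) then 1 else 0)) := by
  -- pointwise: coordinates `(w i₀, w j, w l)`, and on the cone the value is `c·w_{i₀}²`
  have hcongr : (univ.filter fun w : Fin 3 → k => w ≠ 0 ∧ w ⬝ᵥ (diagonal δ *ᵥ w) = 0 ∧ P (w ⬝ᵥ ((diagonal δ * diagonal y) *ᵥ w))) =
      univ.filter fun w : Fin 3 → k => ¬ (w i₀ = 0 ∧ w j = 0 ∧ w l = 0) ∧ δ i₀ * w i₀ ^ 2 + δ j * w j ^ 2 + δ l * w l ^ 2 = 0 ∧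
        P ((y i₀ - y j) * δ i₀ * w i₀ ^ 2) := by
    refine Finset.filter_congr fun w _ => ?_
    have h0 : w ≠ 0 ↔ ¬ (w i₀ = 0 ∧ w j = 0 ∧ w l = 0) := by
      refine not_congr ⟨fun h => by simp [h], fun h => funext fun m => ?_⟩
      rcases fin_three_eq_or_of_distinct i₀ j l m hij hil hjl with rfl | rfl | rfl
      exacts [h.1, h.2.1, h.2.2]
    have hcone : w ⬝ᵥ (diagonal δ *ᵥ w) = δ i₀ * w i₀ ^ 2 + δ j * w j ^ 2 + δ l * w l ^ 2 := by
      rw [dotProduct_diagonal_mulVec_self, sum_univ_fin_three_of_distinct _ hij hil hjl]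
    have hval : w ⬝ᵥ ((diagonal δ * diagonal y) *ᵥ w) = δ i₀ * y i₀ * w i₀ ^ 2 + δ j * y j * w j ^ 2 + δ l * y l * w l ^ 2 := by
      rw [dotProduct_diagonal_mul_diagonal_mulVec_self, sum_univ_fin_three_of_distinct _ hij hil hjl]
    rw [h0, hcone, hval]
    refine and_congr_right fun _ => and_congr_right fun hc => ?_
    rw [show δ i₀ * y i₀ * w i₀ ^ 2 + δ j * y j * w j ^ 2 + δ l * y l * w l ^ 2 = (y i₀ - y j) * δ i₀ * w i₀ ^ 2 by rw [← hy]; linear_combination (y j) * hc]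
  rw [hcongr, card_filter_fin_three_coords_eq hij hil hjl
    (fun a b c => ¬ (a = 0 ∧ b = 0 ∧ c = 0) ∧ δ i₀ * a ^ 2 + δ j * b ^ 2 + δ l * c ^ 2 = 0 ∧ P ((y i₀ - y j) * δ i₀ * a ^ 2))]
  have hcongr' : (univ.filter fun v : k × k × k => ¬ (v.1 = 0 ∧ v.2.1 = 0 ∧ v.2.2 = 0) ∧ δ i₀ * v.1 ^ 2 + δ j * v.2.1 ^ 2 + δ l * v.2.2 ^ 2 = 0 ∧
      P ((y i₀ - y j) * δ i₀ * v.1 ^ 2)) =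
      univ.filter fun v : k × k × k => v ≠ 0 ∧ δ i₀ * v.1 ^ 2 + δ j * v.2.1 ^ 2 + δ l * v.2.2 ^ 2 = 0 ∧ P ((y i₀ - y j) * δ i₀ * v.1 ^ 2) := by
    refine Finset.filter_congr fun v _ => and_congr_left fun _ => not_congr ⟨fun h => Prod.ext h.1 (Prod.ext h.2.1 h.2.2), fun h => by simp [h]⟩
  rw [hcongr', card_iso_rootFrame_prod_pred_eq hk (hδ i₀) (hδ j) (hδ l) ((y i₀ - y j) * δ i₀) P hP]

/-- The same in `Set.ncard` form (no decidability): the currency of ★ `QuadraticFormCountCongruence.ncard_setOf_ne_zero_congr_frame_eq`. [cite: Kottwitz1986, §3] -/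
theorem ncard_iso_rootFrame_pred_eq (hk : ringChar k ≠ 2) {i₀ j l : Fin 3} (hij : i₀ ≠ j) (hil : i₀ ≠ l) (hjl : j ≠ l)
    (δ : Fin 3 → k) (hδ : ∀ m, δ m ≠ 0) (y : Fin 3 → k) (hy : y j = y l)
    (P : k → Prop) [DecidablePred P] (hP : ∀ c t : k, c ≠ 0 → (P (c * c * t) ↔ P t)) :
    (({w : Fin 3 → k | w ≠ 0 ∧ w ⬝ᵥ (diagonal δ *ᵥ w) = 0 ∧ P (w ⬝ᵥ ((diagonal δ * diagonal y) *ᵥ w))}.ncard : ℕ) : ℤ) =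
      (Fintype.card k - 1) * ((1 + quadraticChar k (-(δ j * δ l))) * (if P 0 then 1 else 0) +
        (Fintype.card k - quadraticChar k (-(δ j * δ l))) * (if P ((y i₀ - y j) * δ i₀) then 1 else 0)) := by
  rw [← Finset.coe_filter_univ, Set.ncard_coe_finset]
  exact card_iso_rootFrame_pred_eq hk hij hil hjl δ hδ y hy P (fun t z hz => by rw [pow_two]; exact hP z t hz)

/-- **THE ROOT CENSUS, `J̄₀`-currency**: if `Ā ∈ GL₃(k)` diagonalises the Gram and the value matrix — `ᵗĀ·J̄₀·Ā = diag(δ)` (orthogonal eigenframe) and `Ā⁻¹·Ȳ·Ā = diag(y)`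
(`y j = y l` on the close pair) — then `#{x ≠ 0 : ᵗxJ̄₀x = 0 ∧ P(ᵗx(J̄₀Ȳ)x)} = (q − 1)·((1 + χ(−δ_jδ_l))·[P 0] + (q − χ(−δ_jδ_l))·[P((y_{i₀} − y_j)δ_{i₀})])`
(★ frame change `x = Āb`). [cite: Rogawski1990, §4.9 Prop. 4.9.1 p. 55] [cite: Kottwitz1986, §3] -/
theorem ncard_iso_antidiagonal_pred_eq_of_frame (hk : ringChar k ≠ 2) {i₀ j l : Fin 3} (hij : i₀ ≠ j) (hil : i₀ ≠ l) (hjl : j ≠ l)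
    (δ : Fin 3 → k) (hδ : ∀ m, δ m ≠ 0) (y : Fin 3 → k) (hy : y j = y l)
    (A : GL (Fin 3) k) (Y : Matrix (Fin 3) (Fin 3) k)
    (hG : ((A : Matrix (Fin 3) (Fin 3) k))ᵀ * ((StdForm.antidiagonal 3).over k) * (A : Matrix (Fin 3) (Fin 3) k) = diagonal δ)
    (hY : ((A⁻¹ : GL (Fin 3) k) : Matrix (Fin 3) (Fin 3) k) * Y * (A : Matrix (Fin 3) (Fin 3) k) = diagonal y)
    (P : k → Prop) [DecidablePred P] (hP : ∀ c t : k, c ≠ 0 → (P (c * c * t) ↔ P t)) :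
    (({x : Fin 3 → k | x ≠ 0 ∧ x ⬝ᵥ (((StdForm.antidiagonal 3).over k) *ᵥ x) = 0 ∧ P (x ⬝ᵥ ((((StdForm.antidiagonal 3).over k) * Y) *ᵥ x))}.ncard : ℕ) : ℤ) =
      (Fintype.card k - 1) * ((1 + quadraticChar k (-(δ j * δ l))) * (if P 0 then 1 else 0) +
        (Fintype.card k - quadraticChar k (-(δ j * δ l))) * (if P ((y i₀ - y j) * δ i₀) then 1 else 0)) := by
  have h := ncard_setOf_ne_zero_congr_frame_eq A ((StdForm.antidiagonal 3).over k) Y (fun a b => a = 0 ∧ P b)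
  simp only [hG, hY] at h
  rw [← h]
  exact ncard_iso_rootFrame_pred_eq hk hij hil hjl δ hδ y hy P hP

/-- **THE ROOT LINE CENSUS** (normalised-parameter currency of the ★ root bridge `UnitaryLatticeTree.ncard_neighborSet_root_pred_eq_natCard`): under the same frame data,
`#{p : P(Q_Ȳ(x̄_p))} = (1 + χ(−δ_jδ_l))·[P 0] + (q − χ(−δ_jδ_l))·[P((y_{i₀} − y_j)δ_{i₀})]` — the `q + 1` root lines are the `1 + χ` NULL lines of the root plane and
`q − χ` lines of ONE class. [cite: Rogawski1990, §4.9 Prop. 4.9.1 p. 55] [cite: Kottwitz1986, §3] -/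
theorem natCard_params_rootFrame_pred_eq (hk : ringChar k ≠ 2) {i₀ j l : Fin 3} (hij : i₀ ≠ j) (hil : i₀ ≠ l) (hjl : j ≠ l)
    (δ : Fin 3 → k) (hδ : ∀ m, δ m ≠ 0) (y : Fin 3 → k) (hy : y j = y l)
    (A : GL (Fin 3) k) (Y : Matrix (Fin 3) (Fin 3) k)
    (hG : ((A : Matrix (Fin 3) (Fin 3) k))ᵀ * ((StdForm.antidiagonal 3).over k) * (A : Matrix (Fin 3) (Fin 3) k) = diagonal δ)
    (hY : ((A⁻¹ : GL (Fin 3) k) : Matrix (Fin 3) (Fin 3) k) * Y * (A : Matrix (Fin 3) (Fin 3) k) = diagonal y)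
    (P : k → Prop) [DecidablePred P] (hP : ∀ c t : k, c ≠ 0 → (P (c * c * t) ↔ P t)) :
    ((Nat.card {p : Option {p : k × k // p.2 + (RingHom.id k) p.2 + p.1 * (RingHom.id k) p.1 = 0} //
        P ((p.elim (Pi.single 2 1) fun q => ![(1 : k), q.1.1, q.1.2]) ⬝ᵥ
          (((((StdForm.antidiagonal 3).over k) * Y) *ᵥ (p.elim (Pi.single 2 1) fun q => ![(1 : k), q.1.1, q.1.2]))))} : ℕ) : ℤ) =
      (1 + quadraticChar k (-(δ j * δ l))) * (if P 0 then 1 else 0) +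
        (Fintype.card k - quadraticChar k (-(δ j * δ l))) * (if P ((y i₀ - y j) * δ i₀) then 1 else 0) := by
  have hmul := card_sub_one_mul_natCard_params_eq_ncard Y P hP
  have hq : (Nat.card k : ℤ) = Fintype.card k := by rw [Nat.card_eq_fintype_card]
  have hq1 : (Fintype.card k : ℤ) - 1 ≠ 0 := by
    have : 1 < Fintype.card k := Fintype.one_lt_card
    omega
  have h := ncard_iso_antidiagonal_pred_eq_of_frame hk hij hil hjl δ hδ y hy A Y hG hY P hP
  rw [← hmul, Nat.cast_mul, Nat.cast_sub (Nat.one_le_iff_ne_zero.2 (Nat.card_pos (α := k)).ne'), hq, Nat.cast_one] at h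
  exact mul_left_cancel₀ hq1 h

/-- ROOT LINE CENSUS, NULL lines: with `y i₀ ≠ y j` (the isolated eigenvalue IS isolated residually) the root has `1 + χ(−δ_jδ_l)` null lines — `2` for a residually
HYPERBOLIC root plane, `0` for an ANISOTROPIC one (socket S5′: the bare literal has no null root line). [cite: Rogawski1990, §4.9 Prop. 4.9.1 p. 55] [cite: Kottwitz1986, §3] -/
theorem natCard_params_rootFrame_null_eq (hk : ringChar k ≠ 2) {i₀ j l : Fin 3} (hij : i₀ ≠ j) (hil : i₀ ≠ l) (hjl : j ≠ l)
    (δ : Fin 3 → k) (hδ : ∀ m, δ m ≠ 0) (y : Fin 3 → k) (hy : y j = y l) (hyy : y i₀ ≠ y j)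
    (A : GL (Fin 3) k) (Y : Matrix (Fin 3) (Fin 3) k)
    (hG : ((A : Matrix (Fin 3) (Fin 3) k))ᵀ * ((StdForm.antidiagonal 3).over k) * (A : Matrix (Fin 3) (Fin 3) k) = diagonal δ)
    (hY : ((A⁻¹ : GL (Fin 3) k) : Matrix (Fin 3) (Fin 3) k) * Y * (A : Matrix (Fin 3) (Fin 3) k) = diagonal y) :
    ((Nat.card {p : Option {p : k × k // p.2 + (RingHom.id k) p.2 + p.1 * (RingHom.id k) p.1 = 0} //
        (p.elim (Pi.single 2 1) fun q => ![(1 : k), q.1.1, q.1.2]) ⬝ᵥ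
          (((((StdForm.antidiagonal 3).over k) * Y) *ᵥ (p.elim (Pi.single 2 1) fun q => ![(1 : k), q.1.1, q.1.2]))) = 0} : ℕ) : ℤ) =
      1 + quadraticChar k (-(δ j * δ l)) := by
  have h := natCard_params_rootFrame_pred_eq hk hij hil hjl δ hδ y hy A Y hG hY (fun t => t = 0) (fun c t hc => by simp [hc])
  have hc : ¬ ((y i₀ - y j) * δ i₀ = 0) := mul_ne_zero (sub_ne_zero.2 hyy) (hδ i₀)
  simp only [if_true, if_neg hc, mul_one, mul_zero, add_zero] at h
  exact h

/-- ROOT LINE CENSUS, CLASS lines: the root lines whose value has `χ(c₀·value) = ε` (`ε = ±1`) number `(q − χ(−δ_jδ_l))·[χ(c₀·(y_{i₀} − y_j)δ_{i₀}) = ε]` — ALL the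
non-null root lines lie in ONE class (`q − 1` of them at a hyperbolic root, `q + 1` at an anisotropic one: socket S5′). [cite: Rogawski1990, §4.9 Prop. 4.9.1 p. 55]
[cite: IrelandRosen1990, Ch. 8 §1] -/
theorem natCard_params_rootFrame_quadraticChar_eq (hk : ringChar k ≠ 2) {i₀ j l : Fin 3} (hij : i₀ ≠ j) (hil : i₀ ≠ l) (hjl : j ≠ l)
    (δ : Fin 3 → k) (hδ : ∀ m, δ m ≠ 0) (y : Fin 3 → k) (hy : y j = y l)
    (A : GL (Fin 3) k) (Y : Matrix (Fin 3) (Fin 3) k)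
    (hG : ((A : Matrix (Fin 3) (Fin 3) k))ᵀ * ((StdForm.antidiagonal 3).over k) * (A : Matrix (Fin 3) (Fin 3) k) = diagonal δ)
    (hY : ((A⁻¹ : GL (Fin 3) k) : Matrix (Fin 3) (Fin 3) k) * Y * (A : Matrix (Fin 3) (Fin 3) k) = diagonal y)
    (c₀ : k) {ε : ℤ} (hε : ε = 1 ∨ ε = -1) :
    ((Nat.card {p : Option {p : k × k // p.2 + (RingHom.id k) p.2 + p.1 * (RingHom.id k) p.1 = 0} //
        quadraticChar k (c₀ * ((p.elim (Pi.single 2 1) fun q => ![(1 : k), q.1.1, q.1.2]) ⬝ᵥ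
          (((((StdForm.antidiagonal 3).over k) * Y) *ᵥ (p.elim (Pi.single 2 1) fun q => ![(1 : k), q.1.1, q.1.2]))))) = ε} : ℕ) : ℤ) =
      (Fintype.card k - quadraticChar k (-(δ j * δ l))) * (if quadraticChar k (c₀ * ((y i₀ - y j) * δ i₀)) = ε then 1 else 0) := by
  have hP : ∀ c t : k, c ≠ 0 → (quadraticChar k (c₀ * (c * c * t)) = ε ↔ quadraticChar k (c₀ * t) = ε) := fun c t hc => by
    rw [show c₀ * (c * c * t) = c₀ * t * c ^ 2 by ring, map_mul, map_pow, quadraticChar_sq_one hc, mul_one]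
  have h := natCard_params_rootFrame_pred_eq hk hij hil hjl δ hδ y hy A Y hG hY (fun t => quadraticChar k (c₀ * t) = ε) hP
  have h0 : ¬ (quadraticChar k 0 = ε) := by
    rw [MulChar.map_zero]; rcases hε with rfl | rfl <;> decide
  simp only [mul_zero, if_neg h0, zero_add] at h
  exact h

end Literature.NumberTheory.Rogawski1990
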